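import Summits.QuantumFields.BalabanUV.T4Continuum.Spine.NE1p.DressedRoot
import Summits.QuantumFields.BalabanUV.T4Continuum.Support.NE1pFamilyBudget

/-!
# T⁴ programme, spine estimate NE1′ (node O3b/H2) — THE ROW ROOT IN BUDGET FORM and its END from the FAMILY-INDEXED leaves (the
# owner's format ruling on the wall's «history price» doors, at the root)

Cell `pub-balaban`, sub-cell `t4`, BINDER-OWNERS row NE1′; owner lineage t4-ne1p-p1 (PROVER seat P1 «RG-trajectory comparison»),
generation 23; tree target `Summits/QuantumFields/BalabanUV/T4Continuum/Spine/NE1p/`; ADDITIVE — imports `Spine/NE1p/DressedRoot` and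
`Support/NE1pFamilyBudget` (the ideation seat t4-ne1p-p2 g29's family format, couriered by the owner) ONLY, modifies nothing.

WHY THIS FILE.  `DressedRoot.DressedStability` books NE1′ as a UNIFORM two-rate CLASS of every observable-attached term.  The synthesis
wall (`t4/ideate/NE1p-WALL.md` §1/§3/§5) has located THE NUMBER of the node — the per-met-step action-oscillation margin (w2-act) is,
from print, only boundable EXTENSIVELY in the met component's large-field history (GAPS G-adv3-21) — and typed three DOORS for paying
that history price (door 1 «met steps are births», door 2 a K-free cap per family, door 3 (PAY)∕(B-PAY) one debit at the old births);
behind every door the booking carries FAMILY-indexed rates and classes, and `NE1pFamilyBudget.card_le_sumH` records that the booking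
cannot hide the history weights: per-term sizes are then `H f ×` the uniform class, and what stays uniform is the BUDGET, provided the
felt∕live families are counted WITH their weights.  So the root OF RECORD that every door can feed is the budget form; the class form
is the stronger sufficient condition (doors that pay INTO the class at birth keep it).  This file types exactly that:

* §1 `DressedBudget 𝒯 w` [shape] — ROOT-B: ONE constant `c_B` such that at EVERY cutoff and run parameter the per-cube budget (TOB-k)
  `Σ_{j≤k} w_j·load ≤ c_B` holds for the run's weight profile `w p K` ([print B13 (2.20) p. 16] per-point locus; T4-REF-O3 V2 (c));
  `cubeBudget_of_classAt_strict` ∕ `dressedBudget_of_dressedStabilityWith_strict` [bookkeeping] — ROOT-C (the class form) + K-free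
  positional counts + the STRICT product `Λρ₁τ ≤ r < 1` + weights `≤ w̄` ⟹ ROOT-B with `c_B = w̄·N₀A₀/(1−r)`, K-FREE WITHOUT summable
  weights (`T4PreservedUnderT.sum_count_twoRate_le` + `T4GatedBooking.cubeBudgetAt_of_sizeBoundAt` by name; `twoRate_eq` identifies
  this lineage's `twoRate` with `T4PreservedUnderT.twoRate`).
* §2 `BookingLeavesFam U Bk T` [data + hypothesis shapes] — the per-cutoff leaf bundle in the FAMILY format: family birth constants
  `C b`, history weights `H b`, family rates `ρ b k`, regeneration `c b k`, family classes `σ b k ≤ H b·twoRate …` (all `k ≤ K`),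
  action margins, live-family finsets with the WEIGHTED count `hcountH`, and the binders of `NE1pFamilyBudget.dressedBudgetFam_closed`
  (`BirthsFromOldFam`, `TransportsFromVarFam`, `RegeneratesFromVarFam`, per-family compatibility `hrate`); `weightedSize_of_bookingLeavesFam`
  — every term's size is `≤ H b ×` the uniform class at every scale (and every family gate holds); `cubeBudget_of_bookingLeavesFam` — with
  the weighted count on the CUBES (`hcountHq : Σ_{b felt at q, born at j} H b ≤ N₀Λ^{k−j}`) the budget `w̄·N₀A₀/(1−ρ′)`;
  **`dressedBudget_of_familyLeaves`** — END-B-fam: ONE `U` at every `(p, K)` ⟹ ROOT-B.  The uniform leaves of `DressedRoot` are the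
  case `H ≡ 1`, `C` constant.

HONEST FRAMING.  Rung (B)+1 bookkeeping on ONE finite four-torus — NOT infinite volume, NOT a mass gap, NOT Clay, NOT summit progress.
NE1′ is NOT PRINTED and NOT PROVED; every headline reads «root ⇐ the named binders»; 0 binders instantiated on Bałaban's densities;
the history weights `H`, their weighted counts and every class∕rate∕birth statement are HYPOTHESES about the cell's instantiation —
in particular NOTHING here pays the history price: the file only books WHERE it must be paid (`hcountH`∕`hcountHq`, or inside `C b`
at birth).  [folklore] kernel glue, 0 sorry, 0 citations used as facts.  Spine PROVED 0∕9 unchanged.  HONEST DEPENDENCY: continuum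
YM on T⁴ ⇐ BetaPertH ∧ nine spine estimates (0/9 proved); BetaPertH ⇐ (D1) ∧ (D4) ∧ CAP+tail; G-an2-4 gates asym, D1 and NE2/3/4.
-/

noncomputable section

namespace Summit.QuantumFields.BalabanUV.T4Continuum.NE1p.DressedRoot

open Finset
open scoped BigOperators
open Literature.MathematicalPhysics.QuantumFieldTheory.Balaban1983to89
open Literature.MathematicalPhysics.QuantumFieldTheory.Balaban1983to89.T4TermFormat
open Literature.MathematicalPhysics.QuantumFieldTheory.Balaban1983to89.T4TermFormat.Booking
open Literature.MathematicalPhysics.QuantumFieldTheory.Balaban1983to89.T4GatedBooking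
open Literature.MathematicalPhysics.QuantumFieldTheory.Balaban1983to89.T4TrajectoryComparison
open Summit.QuantumFields.BalabanUV.T4Continuum.T4TrajectoryDensityDressed
open Summit.QuantumFields.BalabanUV.T4Continuum.NE1pFamilyBudget

/-! ## §1 ROOT-B: the budget form, and the class form as its sufficient condition under the strict product -/

/-- **ROOT-B — THE DRESSED BUDGET, UNIFORM IN THE CUTOFF AND THE RUN PARAMETER** [shape]: ONE constant `c_B` such that for every run
parameter `p` and cutoff `K`, every tube cube of the booking `𝒯.B p K` carries `Σ_{j ≤ k} w p K j · load ≤ c_B` for the run's weight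
profile `w p K` (cell reading: `w p K j = g_j^{κ₀′}` along the run's coupling flow; NOT asserted) — the (TOB-k) budget of T4-REF-O3
V2 (c) with a K- and μ-free constant.  NOT PRINTED; NOT PROVED; never asserted. [folklore] -/
def DressedBudget {P : Type*} (𝒯 : DressedTower P) (w : P → ℕ → ℕ → ℝ) : Prop :=
  ∃ cB : ℝ, ∀ p K, (𝒯.B p K).CubeBudget (w p K) cB

/-- This lineage's `twoRate A₀ ρ₁ τ K` IS `T4PreservedUnderT.twoRate K A₀ ρ₁ τ` (argument order only). [folklore] -/
theorem twoRate_eq (A₀ ρ₁ τ : ℝ) (K j k : ℕ) : twoRate A₀ ρ₁ τ K j k = T4PreservedUnderT.twoRate K A₀ ρ₁ τ j k := rfl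

/-- **THE STRICT BUDGET FROM THE CLASS AT ONE CUTOFF** [bookkeeping]: the two-rate class, K-free positional counts `N₀Λ^{k−j}`, the
STRICT product `Λρ₁τ ≤ r < 1` and weights `0 ≤ w j ≤ w̄` give the per-cube budget `w̄·(N₀A₀/(1−r))` — no summability of the
weights needed (`T4PreservedUnderT.sum_count_twoRate_le`, `T4GatedBooking.cubeBudgetAt_of_sizeBoundAt` by name). [folklore] -/
theorem cubeBudget_of_classAt_strict {Bk : T4TermFormat.Booking} {A₀ ρ₁ τ N₀ Λ r wbar : ℝ} {w : ℕ → ℝ}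
    (hA₀ : 0 ≤ A₀) (hρ₁ : 0 ≤ ρ₁) (hτ0 : 0 ≤ τ) (hτ1 : τ ≤ 1) (hN₀ : 0 ≤ N₀) (hΛ : 0 ≤ Λ)
    (hr : Λ * ρ₁ * τ ≤ r) (hr1 : r < 1) (hwbar : 0 ≤ wbar)
    (hw0 : ∀ j ≤ Bk.K, 0 ≤ w j) (hwb : ∀ j ≤ Bk.K, w j ≤ wbar)
    (hcount : Bk.PositionalCount fun j k => N₀ * Λ ^ (k - j)) (hcl : ClassAt Bk A₀ ρ₁ τ) :
    Bk.CubeBudget w (wbar * (N₀ * A₀ / (1 - r))) := by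
  rw [cubeBudget_iff]
  intro k hk
  have hσ0 : ∀ j, 0 ≤ twoRate A₀ ρ₁ τ Bk.K j k := fun j => twoRate_nonneg hA₀ hρ₁ hτ0 _ j k
  refine cubeBudgetAt_of_sizeBoundAt (N := fun j k => N₀ * Λ ^ (k - j)) (σ := twoRate A₀ ρ₁ τ Bk.K)
    (fun j hj => hw0 j (hj.trans hk)) hcount hσ0 ?_ (sizeBound_iff.mp hcl k hk)
  have hNσ0 : ∀ j, 0 ≤ N₀ * Λ ^ (k - j) * twoRate A₀ ρ₁ τ Bk.K j k := fun j =>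
    mul_nonneg (mul_nonneg hN₀ (pow_nonneg hΛ _)) (hσ0 j)
  have hinner : ∑ j ∈ range (k + 1), N₀ * Λ ^ (k - j) * twoRate A₀ ρ₁ τ Bk.K j k ≤ N₀ * A₀ / (1 - r) :=
    T4PreservedUnderT.sum_count_twoRate_le (B := Bk) (N := fun j k => N₀ * Λ ^ (k - j)) hk (fun j _ => le_rfl)
      hN₀ hA₀ hΛ hρ₁ hτ0 hτ1 hr hr1
  calc ∑ j ∈ range (k + 1), w j * (N₀ * Λ ^ (k - j) * twoRate A₀ ρ₁ τ Bk.K j k)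
      ≤ ∑ j ∈ range (k + 1), wbar * (N₀ * Λ ^ (k - j) * twoRate A₀ ρ₁ τ Bk.K j k) :=
        sum_le_sum fun j hj =>
          mul_le_mul_of_nonneg_right (hwb j ((Nat.lt_succ_iff.mp (mem_range.mp hj)).trans hk)) (hNσ0 j)
    _ = wbar * ∑ j ∈ range (k + 1), N₀ * Λ ^ (k - j) * twoRate A₀ ρ₁ τ Bk.K j k := by rw [mul_sum]
    _ ≤ wbar * (N₀ * A₀ / (1 - r)) := mul_le_mul_of_nonneg_left hinner hwbar

/-- **ROOT-C ⟹ ROOT-B under the strict product** [bookkeeping]: the class root with its constants, K-free positional counts at every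
cutoff, `Λρ₁τ ≤ r < 1`, and run weight profiles bounded by ONE `w̄ ≥ 0` give the budget root with `c_B = w̄·N₀A₀/(1−r)`. [folklore] -/
theorem dressedBudget_of_dressedStabilityWith_strict {P : Type*} {𝒯 : DressedTower P} {A₀ ρ₁ τ N₀ Λ r wbar : ℝ}
    {w : P → ℕ → ℕ → ℝ} (h : DressedStabilityWith 𝒯 A₀ ρ₁ τ) (hN₀ : 0 ≤ N₀) (hΛ : 0 ≤ Λ)
    (hr : Λ * ρ₁ * τ ≤ r) (hr1 : r < 1) (hwbar : 0 ≤ wbar)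
    (hw0 : ∀ p K, ∀ j ≤ K, 0 ≤ w p K j) (hwb : ∀ p K, ∀ j ≤ K, w p K j ≤ wbar)
    (hcount : ∀ p K, (𝒯.B p K).PositionalCount fun j k => N₀ * Λ ^ (k - j)) :
    DressedBudget 𝒯 w := by
  obtain ⟨hA₀, hρ₁, hτ0, hτ1, hcl⟩ := h
  refine ⟨wbar * (N₀ * A₀ / (1 - r)), fun p K => ?_⟩
  have hK := 𝒯.K_eq p K
  exact cubeBudget_of_classAt_strict hA₀ hρ₁ hτ0 hτ1 hN₀ hΛ hr hr1 hwbar (by rw [hK]; exact hw0 p K)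
    (by rw [hK]; exact hwb p K) (hcount p K) (hcl p K)

/-! ## §2 END-B-fam: the budget root from the family-indexed leaves -/

/-- **THE LEAF BINDERS AT ONE CUTOFF IN THE FAMILY FORMAT** [data + hypothesis shapes] (the doors' common booking): family birth
constants `C b`, HISTORY WEIGHTS `H b` (door 2: `e^{η·m̄}` under a K-free cap; door 3: 1 after payment at birth; reading (I) of
`NE1pFamilyBudgetFn.transportsFromVarFam_dom`: the dominating constant), family rates `ρ b k` and regeneration constants `c b k`,
family classes `σ b k` dominated by `H b ×` the uniform two-rate class at EVERY scale `k ≤ K` (`hσ`), action margins `s⁰ ≤ s̄⁰`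
((w2-act) per met component — THE NUMBER stays here), live-family finsets `S k b` counted WITH THEIR WEIGHTS (`hcountH`), and the
binders of `NE1pFamilyBudget.dressedBudgetFam_closed`: (w1)+(w5b) `hbirth : BirthsFromOldFam`, T `htr : TransportsFromVarFam`, (w5)
`hreg : RegeneratesFromVarFam`, (w7) per-family compatibility `hrate`.  The gate is the family budget `budgetGateFam` itself.  NOT
asserted for the cell's terms. [folklore] -/
structure BookingLeavesFam (U : UniformConstants) (Bk : T4TermFormat.Booking) (T : Trajectory Bk) where
  /-- family birth (transport) constants -/
  C : Bk.Birth → ℝ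
  /-- history weights -/
  H : Bk.Birth → ℝ
  /-- family per-step rates -/
  ρ : Bk.Birth → ℕ → ℝ
  /-- family regeneration constants -/
  c : Bk.Birth → ℕ → ℝ
  /-- family classes -/
  σ : Bk.Birth → ℕ → ℝ
  /-- per-family, per-step action oscillation margins -/
  s₀ : Bk.Birth → ℕ → ℝ
  /-- live families of the met component of `b` at step `k` -/
  S : ℕ → Bk.Birth → Finset Bk.Birth
  hC : ∀ b, 0 ≤ C b
  hρ : ∀ b k, 0 ≤ ρ b k
  hc : ∀ b k, 0 ≤ c b k
  /-- (w7) per-family class compatibility -/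
  hrate : ∀ b k, Bk.birthScale b ≤ k → k < Bk.K → (ρ b k + C b * c b k) * σ b k ≤ σ b (k + 1)
  /-- the family classes are the history weight times the uniform class, at every scale -/
  hσ : ∀ f k, Bk.birthScale f ≤ k → k ≤ Bk.K →
    σ f k ≤ H f * (U.A₀ * U.ρ₁ ^ (k - Bk.birthScale f) * U.τ ^ (Bk.K - Bk.birthScale f))
  /-- (w3-book) live families are born -/
  hS : ∀ k b, ∀ f ∈ S k b, Bk.birthScale f ≤ k
  /-- (w3-book) the WEIGHTED count of the live families per birth scale -/
  hcountH : ∀ k b, ∀ j ≤ k, ∑ f ∈ (S k b).filter (fun f => Bk.birthScale f = j), H f ≤ U.N₀ * U.Λ ^ (k - j)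
  /-- (w2-act) per-step action margin -/
  hs₀ : ∀ b k, s₀ b k ≤ U.sbar
  /-- (w1)+(w5b) history-sourced births in the family classes -/
  hbirth : BirthsFromOldFam T C ρ σ (budgetGateFam T s₀ U.m S C ρ)
  /-- T: gated family-rate transport -/
  htr : TransportsFromVarFam T C ρ (budgetGateFam T s₀ U.m S C ρ)
  /-- (w5)∕O-G2: gated family regeneration -/
  hreg : RegeneratesFromVarFam T c (budgetGateFam T s₀ U.m S C ρ)

/-- **ONE CUTOFF, FAMILY FORMAT** [bookkeeping]: every term's size is at most its HISTORY WEIGHT times the uniform class at every scale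
`k ∈ [j_b, K]`, and every family budget gate along the trajectory holds — `dressedBudgetFam_closed` (envelope bounds + gates) then
`size_le_envVarFam` under the history. [folklore] -/
theorem weightedSize_of_bookingLeavesFam {U : UniformConstants} {Bk : T4TermFormat.Booking} {T : Trajectory Bk}
    (L : BookingLeavesFam U Bk T) :
    (∀ (b : Bk.Birth) (k : ℕ), Bk.birthScale b ≤ k → k ≤ Bk.K →
        Bk.size b k ≤ L.H b * twoRate U.A₀ U.ρ₁ U.τ Bk.K (Bk.birthScale b) k) ∧
      ∀ k, k ≤ Bk.K → RanBelow (budgetGateFam T L.s₀ U.m L.S L.C L.ρ) k := by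
  have h := dressedBudgetFam_closed (T := T) L.hC L.hρ L.hc U.hm U.hA₀ U.hρ₁ U.hτ0 U.hτ1 U.hΛ U.hN₀ U.hρ'1 U.hprod L.hS
    L.hcountH (fun f k hf hk => L.hσ f k hf hk.le) L.hs₀ U.hsmall L.hbirth L.hrate L.htr L.hreg
  refine ⟨fun b k hbk hk => ?_, fun k hk => (h k hk).2⟩
  exact ((size_le_envVarFam (T := T) L.htr hbk hk (h k hk).2).trans ((h k hk).1 b hbk)).trans (L.hσ b k hbk hk)

/-- **THE BUDGET AT ONE CUTOFF FROM THE FAMILY LEAVES** [bookkeeping]: with the history-WEIGHTED count of the families FELT at every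
cube (`hcountHq : Σ_{b felt at q, born at j} H b ≤ N₀Λ^{k_q−j}` — the cube-side twin of `hcountH`; whoever pays the history price
certifies it) and weights `0 ≤ w j ≤ w̄`, every cube carries `Σ_{j≤k} w_j·load ≤ w̄·N₀A₀/(1−ρ′)`. [folklore] -/
theorem cubeBudget_of_bookingLeavesFam {U : UniformConstants} {Bk : T4TermFormat.Booking} {T : Trajectory Bk}
    (L : BookingLeavesFam U Bk T) {w : ℕ → ℝ} {wbar : ℝ} (hwbar : 0 ≤ wbar)
    (hw0 : ∀ j ≤ Bk.K, 0 ≤ w j) (hwb : ∀ j ≤ Bk.K, w j ≤ wbar)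
    (hcountHq : ∀ (q : Bk.Cube) (j : ℕ), j ≤ Bk.cubeScale q →
      ∑ b ∈ Bk.feltOfScale q j, L.H b ≤ U.N₀ * U.Λ ^ (Bk.cubeScale q - j)) :
    Bk.CubeBudget w (wbar * (U.N₀ * U.A₀ / (1 - U.ρ'))) := by
  obtain ⟨hsize, -⟩ := weightedSize_of_bookingLeavesFam L
  intro q
  set k := Bk.cubeScale q with hkdef
  have hk : k ≤ Bk.K := Bk.cube_le q
  have hσ0 : ∀ j, 0 ≤ twoRate U.A₀ U.ρ₁ U.τ Bk.K j k := fun j => twoRate_nonneg U.hA₀ U.hρ₁ U.hτ0 _ j k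
  -- the load of birth scale `j` at `q` is at most (weighted count) × (uniform class)
  have hload : ∀ j, j ≤ k → Bk.load q j ≤ U.N₀ * U.Λ ^ (k - j) * twoRate U.A₀ U.ρ₁ U.τ Bk.K j k := by
    intro j hj
    unfold Booking.load
    calc ∑ b ∈ Bk.feltOfScale q j, Bk.size b (Bk.cubeScale q)
        ≤ ∑ b ∈ Bk.feltOfScale q j, L.H b * twoRate U.A₀ U.ρ₁ U.τ Bk.K j k := by
          refine sum_le_sum fun b hb => ?_
          obtain ⟨hb1, hb2⟩ := mem_feltOfScale.mp hb
          have h := hsize b k (by rw [hkdef]; exact Bk.felt_birth_le q b hb1) hk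
          rw [hb2] at h
          exact h
      _ = (∑ b ∈ Bk.feltOfScale q j, L.H b) * twoRate U.A₀ U.ρ₁ U.τ Bk.K j k := by rw [sum_mul]
      _ ≤ U.N₀ * U.Λ ^ (k - j) * twoRate U.A₀ U.ρ₁ U.τ Bk.K j k :=
          mul_le_mul_of_nonneg_right (hcountHq q j hj) (hσ0 j)
  have hNσ0 : ∀ j, 0 ≤ U.N₀ * U.Λ ^ (k - j) * twoRate U.A₀ U.ρ₁ U.τ Bk.K j k := fun j =>
    mul_nonneg (mul_nonneg U.hN₀ (pow_nonneg U.hΛ _)) (hσ0 j)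
  have hinner : ∑ j ∈ range (k + 1), U.N₀ * U.Λ ^ (k - j) * twoRate U.A₀ U.ρ₁ U.τ Bk.K j k ≤ U.N₀ * U.A₀ / (1 - U.ρ') :=
    T4PreservedUnderT.sum_count_twoRate_le (B := Bk) (N := fun j k => U.N₀ * U.Λ ^ (k - j)) hk (fun j _ => le_rfl)
      U.hN₀ U.hA₀ U.hΛ U.hρ₁ U.hτ0 U.hτ1 U.hprod U.hρ'1
  calc ∑ j ∈ range (Bk.cubeScale q + 1), w j * Bk.load q j
      ≤ ∑ j ∈ range (k + 1), wbar * (U.N₀ * U.Λ ^ (k - j) * twoRate U.A₀ U.ρ₁ U.τ Bk.K j k) := by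
        rw [← hkdef]
        refine sum_le_sum fun j hj => ?_
        have hjk : j ≤ k := Nat.lt_succ_iff.mp (mem_range.mp hj)
        calc w j * Bk.load q j ≤ w j * (U.N₀ * U.Λ ^ (k - j) * twoRate U.A₀ U.ρ₁ U.τ Bk.K j k) :=
              mul_le_mul_of_nonneg_left (hload j hjk) (hw0 j (hjk.trans hk))
          _ ≤ wbar * (U.N₀ * U.Λ ^ (k - j) * twoRate U.A₀ U.ρ₁ U.τ Bk.K j k) :=
              mul_le_mul_of_nonneg_right (hwb j (hjk.trans hk)) (hNσ0 j)
    _ = wbar * ∑ j ∈ range (k + 1), U.N₀ * U.Λ ^ (k - j) * twoRate U.A₀ U.ρ₁ U.τ Bk.K j k := by rw [mul_sum]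
    _ ≤ wbar * (U.N₀ * U.A₀ / (1 - U.ρ')) := mul_le_mul_of_nonneg_left hinner hwbar

/-- **END-B-fam — ROOT-B FROM THE FAMILY-INDEXED LEAF BINDERS WITH UNIFORM CONSTANTS** [bookkeeping]: ONE `U : UniformConstants`
serving the family leaf bundle at every `(p, K)`, the weighted felt counts, and run weight profiles bounded by one `w̄ ≥ 0` give
`DressedBudget 𝒯 w` with `c_B = w̄·N₀A₀/(1−ρ′)` — the door-neutral END of the row: whichever door pays the history price does so by
certifying `hcountH`∕`hcountHq` with its weights `H` (doors 2∕reading (I)) or by keeping `H ≡ 1` and paying inside `C b` at birth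
(doors 1∕3). [folklore] -/
theorem dressedBudget_of_familyLeaves {P : Type*} (U : UniformConstants) (𝒯 : DressedTower P)
    (L : ∀ p K, BookingLeavesFam U (𝒯.B p K) (𝒯.T p K)) {w : P → ℕ → ℕ → ℝ} {wbar : ℝ} (hwbar : 0 ≤ wbar)
    (hw0 : ∀ p K, ∀ j ≤ K, 0 ≤ w p K j) (hwb : ∀ p K, ∀ j ≤ K, w p K j ≤ wbar)
    (hcountHq : ∀ p K (q : (𝒯.B p K).Cube) (j : ℕ), j ≤ (𝒯.B p K).cubeScale q →
      ∑ b ∈ (𝒯.B p K).feltOfScale q j, (L p K).H b ≤ U.N₀ * U.Λ ^ ((𝒯.B p K).cubeScale q - j)) :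
    DressedBudget 𝒯 w := by
  refine ⟨wbar * (U.N₀ * U.A₀ / (1 - U.ρ')), fun p K => ?_⟩
  have hK := 𝒯.K_eq p K
  exact cubeBudget_of_bookingLeavesFam (L p K) hwbar (by rw [hK]; exact hw0 p K) (by rw [hK]; exact hwb p K)
    (hcountHq p K)

/-- **THE UNIFORM LEAVES ARE THE CASE `H ≡ 1`, `C` CONSTANT** [bookkeeping]: a `BookingLeaves U Bk T` bundle (END-B of `DressedRoot`)
gives a `BookingLeavesFam U Bk T` bundle with `C b := U.C`, `H b := 1`, `ρ b := ρ`, `c b := c`, family classes := the uniform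
class — the tree shapes being the constant case of the family shapes by `Iff.rfl`, and the weighted count being the plain count
(`sumH_one_eq_card`). [folklore] -/
def BookingLeaves.toFam {U : UniformConstants} {Bk : T4TermFormat.Booking} {T : Trajectory Bk} (L : BookingLeaves U Bk T) :
    BookingLeavesFam U Bk T where
  C := fun _ => U.C
  H := fun _ => 1
  ρ := fun _ => L.ρ
  c := fun _ => L.c
  σ := fun b k => twoRate U.A₀ U.ρ₁ U.τ Bk.K (Bk.birthScale b) k
  s₀ := L.s₀
  S := L.S
  hC := fun _ => U.hC
  hρ := fun _ k => L.hρ k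
  hc := fun _ k => L.hc k
  hrate := fun b k hbk hk => twoRate_compat U.hA₀ U.hρ₁ U.hτ0 Bk.K L.hrate _ k hbk hk
  hσ := fun f k _ _ => by rw [one_mul]; exact le_of_eq rfl
  hS := L.hS
  hcountH := fun k b j hj => by rw [sumH_one_eq_card]; exact L.hcount k b j hj
  hs₀ := L.hs₀
  hbirth := birthsFromOldFam_const_iff.mpr L.hbirth
  htr := transportsFromVarFam_const_iff.mpr L.htr
  hreg := regeneratesFromVarFam_const_iff.mpr L.hreg

end Summit.QuantumFields.BalabanUV.T4Continuum.NE1p.DressedRoot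

end
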